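/-
Copyright (c) 2026 the pub-hodgecm-mathlib formalisation cell (harness21).  Prover seat hodgecm-mathlib-K2E1-p08 (g6), Track B ∕ K2-LIT (build stream 29), h413 =
`stmt-HodgeConjecture-24833`, campaigns «EIS-R7-BL-SPH-2∕3», file ℓ12 = P3-D: the `U(2,1)` prints of the (rank-generic) evaluation functionals of ★ parts 2b∕3.
-/
import Summits.HodgeConjecture.HodgeConjecture.Theorems.K2E1BLEvaluationFunctionalUniformU2  -- ★ (this seat) ℓ12 part 3 (brings parts 1∕2a∕2b, ★ P3-C, ★ ℓ9 incl. `hHecke_cm_three`)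
import HarnessLib

/-!
# h413 ∕ Track B «K2-LIT», «EIS-R7-BL-SPH-3» — helper `K2E1BLEvaluationFunctionalCMThree` (ℓ12 = P3-D at `N = 3`): P8₃'s letter `hΛ` and the `hpole` print on `U(2,1)_{L/L⁺}`

Cell `pub/hodgecm-mathlib`, crux H413 = `stmt-HodgeConjecture-24833`, route `HCCMUnconditional`; dealer K2E1-plan (g6).  THEOREMS ONLY (no `def`∕`instance`∕`notation`∕named-fact
hypothesis∕`sorry`); lane `--kind proof --supports stmt-HodgeConjecture-24833 --as helper` (count-neutral).  The evaluation functionals `u ↦ (R(h)u)(g)` on `𝓗_k(𝔛)` and their local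
uniformity in `g` are RANK-GENERIC (★ `K2E1BLEvaluationFunctionalU2.exists_evalCLM`, ★ `K2E1BLEvaluationFunctionalUniformU2.exists_bound_evalCLM_of_isCompact`); this file only
composes them with the `N = 3` Hecke letter ★ ℓ9 `hHecke_cm_three` (Godement range `2 < Re z`, ★ `summable_borelHeight_rpow_cm_three`) — the two `N = 2` prints with `1 ↦ 2`, `2 ↦ 3`.
* **`exists_evalCLM_eisenstein_cm_three`**: `∃ Λ : 𝓗_k(𝔛) →L[ℂ] ℂ, ∀ z, 2 < Re z → Λ (toHX E(φ₀H^z)) = ĥ(z)·E(φ₀H^z)(g)` (P8₃'s `hΛ`).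
* **`exists_bound_eisenstein_cm_three`**: `∃ C₀, ∀ g ∈ Cpt, ∀ z, 2 < Re z → ‖ĥ(z)·E(φ₀H^z)(g)‖ ≤ C₀·‖toHX E(φ₀H^z)‖` (the `hpole`∕(R-b)₃ print).
HONEST LABEL.  Count-neutral helper; closes no socket; HC_CM is proved only modulo the 7 printed citations (2 remaining named inputs: hLiu418 = `stmt-HodgeConjecture-24832`, h413 =
`stmt-HodgeConjecture-24833`) until rung 0 closes.  References: [BernsteinLapid2019] J. Bernstein, E. Lapid, *On the meromorphic continuation of Eisenstein series*, JAMS 37 (2024)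
(arXiv:1911.02342), §4 p. 10, Claim 1(a) p. 9; [GetzHahn2024] J. R. Getz, H. Hahn, *An Introduction to Automorphic Representations*, GTM 300 (2024), Lemma 9.2.4.
-/

set_option autoImplicit false
-- the mandated namespace repeats `HodgeConjecture.HodgeConjecture`, as in every `Theorems/*.lean` of this sub-problem
set_option linter.dupNamespace false

noncomputable section

open MeasureTheory MeasureTheory.Measure Set NumberField IsDedekindDomain Filter Topology
open scoped NNReal ENNReal
open Literature.NumberTheory.Automorphic Literature.NumberTheory.Automorphic.UnitaryGroup AdelicGroupData
open Summit.HodgeConjecture.HodgeConjecture.Cruxes.H413.K2E1BLBorelSpacesU2Defs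
open Summit.HodgeConjecture.HodgeConjecture.Cruxes.H413.K2E1BLEvaluationFunctionalU2 (exists_evalCLM)
open Summit.HodgeConjecture.HodgeConjecture.Cruxes.H413.K2E1BLEvaluationFunctionalUniformU2 (exists_bound_evalCLM_of_isCompact)
open Summit.HodgeConjecture.HodgeConjecture.Cruxes.H413.K2E1BorelEisensteinU
open Summit.HodgeConjecture.HodgeConjecture.Cruxes.H413.K2E1SphericalEisensteinHeckeEigenU2 (hHecke_cm_three)

namespace Summit.HodgeConjecture.HodgeConjecture.Cruxes.H413.K2E1BLEvaluationFunctionalCMThree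

variable (L : Type) [Field L] [NumberField L] [IsCMField L]
variable [MeasurableSpace (quasiSplit (↥(maximalRealSubfield L)) L (IsCMField.complexConj L) 3).Adelic]
  [BorelSpace (quasiSplit (↥(maximalRealSubfield L)) L (IsCMField.complexConj L) 3).Adelic]

/-- **P8₃'s LETTER `hΛ` ON `U(2,1)_{L/L⁺}`** (★ `exists_evalCLM` ∘ ★ ℓ9 `hHecke_cm_three`, `2 < Re z`): `Λ (toHX E(φ₀H^z)) = (∫ h(x) H(x)^z dν_G)·E(φ₀H^z)(g)`.
[cite: BernsteinLapid2019, §4 p. 10 and Claim 1(a) p. 9] -/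
theorem exists_evalCLM_eisenstein_cm_three (μ : Measure (quasiSplit (↥(maximalRealSubfield L)) L (IsCMField.complexConj L) 3).automorphicQuotient)
    [(quasiSplit (↥(maximalRealSubfield L)) L (IsCMField.complexConj L) 3).IsAutomorphicMeasure μ]
    (νG : Measure (quasiSplit (↥(maximalRealSubfield L)) L (IsCMField.complexConj L) 3).Adelic) [νG.IsHaarMeasure] [νG.IsInvInvariant] (k : ℕ)
    {h : (quasiSplit (↥(maximalRealSubfield L)) L (IsCMField.complexConj L) 3).Adelic → ℝ}
    (hK : ∀ k₀ : (quasiSplit (↥(maximalRealSubfield L)) L (IsCMField.complexConj L) 3).Adelic,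
      adelicVal (↥(maximalRealSubfield L)) L (IsCMField.complexConj L) 3 ((StdForm.antidiagonal 3).over L) k₀ ∈ standardMaximalCompactGL 3 L → ∀ x, h (k₀ * x) = h x)
    (hh : Continuous h) (hhc : HasCompactSupport h) (φ₀ : ℂ) (g : (quasiSplit (↥(maximalRealSubfield L)) L (IsCMField.complexConj L) 3).Adelic) :
    ∃ Λ : HX (↥(maximalRealSubfield L)) L (IsCMField.complexConj L) 3 k μ →L[ℂ] ℂ, ∀ z : ℂ, 2 < z.re →
      ∀ hE : MemLp ((quasiSplit (↥(maximalRealSubfield L)) L (IsCMField.complexConj L) 3).quotFun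
          (eisensteinSeriesU (flatSectionU (fun _ : (quasiSplit (↥(maximalRealSubfield L)) L (IsCMField.complexConj L) 3).Adelic => φ₀) z))) 2
          (μ.withDensity fun x => (((supHeight (↥(maximalRealSubfield L)) L (IsCMField.complexConj L) 3 x)⁻¹ ^ (2 * k) : ℝ≥0) : ℝ≥0∞)),
        Λ (toHX (↥(maximalRealSubfield L)) L (IsCMField.complexConj L) 3 k μ
            (eisensteinSeriesU (flatSectionU (fun _ : (quasiSplit (↥(maximalRealSubfield L)) L (IsCMField.complexConj L) 3).Adelic => φ₀) z)) hE) =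
          (∫ x, ((h x : ℝ) : ℂ) * (((borelHeight x : ℝ)) : ℂ) ^ z ∂νG) *
            eisensteinSeriesU (flatSectionU (fun _ : (quasiSplit (↥(maximalRealSubfield L)) L (IsCMField.complexConj L) 3).Adelic => φ₀) z) g := by
  obtain ⟨Λ, hΛ⟩ := exists_evalCLM μ νG k hh hhc g
  refine ⟨Λ, fun z hz hE => ?_⟩
  have hinv : ∀ γ ∈ (quasiSplit (↥(maximalRealSubfield L)) L (IsCMField.complexConj L) 3).quotientSubgroup, ∀ y,
      eisensteinSeriesU (flatSectionU (fun _ : (quasiSplit (↥(maximalRealSubfield L)) L (IsCMField.complexConj L) 3).Adelic => φ₀) z) (γ * y) =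
        eisensteinSeriesU (flatSectionU (fun _ : (quasiSplit (↥(maximalRealSubfield L)) L (IsCMField.complexConj L) 3).Adelic => φ₀) z) y := by
    intro γ hγ y
    rw [quotientSubgroup_quasiSplit] at hγ
    obtain ⟨γ', hγ'⟩ := MonoidHom.mem_range.1 hγ
    rw [← hγ']
    exact eisensteinSeriesU_flatSectionU_rational_mul (φ := fun _ : (quasiSplit (↥(maximalRealSubfield L)) L (IsCMField.complexConj L) 3).Adelic => φ₀) (fun _ _ _ => rfl) z γ' y
  rw [(hΛ _ hinv hE).2]
  exact hHecke_cm_three L νG hK hh hhc φ₀ z hz g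

/-- **`‖ĥ(z)·E(φ₀H^z)(g)‖ ≤ C₀·‖toHX E(φ₀H^z)‖_{𝓗_k}` UNIFORMLY FOR `g ∈ Cpt` COMPACT ON `U(2,1)_{L/L⁺}`** (`2 < Re z`): ★ `exists_bound_evalCLM_of_isCompact` ∘ ★ ℓ9
`hHecke_cm_three` — the sup-over-compacta control `hpole`∕(R-b)₃ needs. [cite: BernsteinLapid2019, §4 p. 10 and Claim 1(a) p. 9] -/
theorem exists_bound_eisenstein_cm_three (μ : Measure (quasiSplit (↥(maximalRealSubfield L)) L (IsCMField.complexConj L) 3).automorphicQuotient)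
    [(quasiSplit (↥(maximalRealSubfield L)) L (IsCMField.complexConj L) 3).IsAutomorphicMeasure μ]
    (νG : Measure (quasiSplit (↥(maximalRealSubfield L)) L (IsCMField.complexConj L) 3).Adelic) [νG.IsHaarMeasure] [νG.IsInvInvariant] (k : ℕ)
    {h : (quasiSplit (↥(maximalRealSubfield L)) L (IsCMField.complexConj L) 3).Adelic → ℝ}
    (hK : ∀ k₀ : (quasiSplit (↥(maximalRealSubfield L)) L (IsCMField.complexConj L) 3).Adelic,
      adelicVal (↥(maximalRealSubfield L)) L (IsCMField.complexConj L) 3 ((StdForm.antidiagonal 3).over L) k₀ ∈ standardMaximalCompactGL 3 L → ∀ x, h (k₀ * x) = h x)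
    (hh : Continuous h) (hhc : HasCompactSupport h) (φ₀ : ℂ)
    {Cpt : Set (quasiSplit (↥(maximalRealSubfield L)) L (IsCMField.complexConj L) 3).Adelic} (hCpt : IsCompact Cpt) :
    ∃ C₀ : ℝ, ∀ g ∈ Cpt, ∀ z : ℂ, 2 < z.re →
      ∀ hE : MemLp ((quasiSplit (↥(maximalRealSubfield L)) L (IsCMField.complexConj L) 3).quotFun
          (eisensteinSeriesU (flatSectionU (fun _ : (quasiSplit (↥(maximalRealSubfield L)) L (IsCMField.complexConj L) 3).Adelic => φ₀) z))) 2
          (μ.withDensity fun x => (((supHeight (↥(maximalRealSubfield L)) L (IsCMField.complexConj L) 3 x)⁻¹ ^ (2 * k) : ℝ≥0) : ℝ≥0∞)),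
        ‖(∫ x, ((h x : ℝ) : ℂ) * (((borelHeight x : ℝ)) : ℂ) ^ z ∂νG) *
            eisensteinSeriesU (flatSectionU (fun _ : (quasiSplit (↥(maximalRealSubfield L)) L (IsCMField.complexConj L) 3).Adelic => φ₀) z) g‖ ≤
          C₀ * ‖toHX (↥(maximalRealSubfield L)) L (IsCMField.complexConj L) 3 k μ
            (eisensteinSeriesU (flatSectionU (fun _ : (quasiSplit (↥(maximalRealSubfield L)) L (IsCMField.complexConj L) 3).Adelic => φ₀) z)) hE‖ := by
  obtain ⟨C₀, hC₀⟩ := exists_bound_evalCLM_of_isCompact μ νG k hh hhc hCpt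
  refine ⟨C₀, fun g hg z hz hE => ?_⟩
  obtain ⟨Λ, hΛn, hΛ⟩ := hC₀ g hg
  have hinv : ∀ γ ∈ (quasiSplit (↥(maximalRealSubfield L)) L (IsCMField.complexConj L) 3).quotientSubgroup, ∀ y,
      eisensteinSeriesU (flatSectionU (fun _ : (quasiSplit (↥(maximalRealSubfield L)) L (IsCMField.complexConj L) 3).Adelic => φ₀) z) (γ * y) =
        eisensteinSeriesU (flatSectionU (fun _ : (quasiSplit (↥(maximalRealSubfield L)) L (IsCMField.complexConj L) 3).Adelic => φ₀) z) y := by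
    intro γ hγ y
    rw [quotientSubgroup_quasiSplit] at hγ
    obtain ⟨γ', hγ'⟩ := MonoidHom.mem_range.1 hγ
    rw [← hγ']
    exact eisensteinSeriesU_flatSectionU_rational_mul (φ := fun _ : (quasiSplit (↥(maximalRealSubfield L)) L (IsCMField.complexConj L) 3).Adelic => φ₀) (fun _ _ _ => rfl) z γ' y
  rw [← hHecke_cm_three L νG hK hh hhc φ₀ z hz g, ← (hΛ _ hinv hE).2]
  exact (Λ.le_opNorm _).trans (mul_le_mul_of_nonneg_right hΛn (norm_nonneg _))

end Summit.HodgeConjecture.HodgeConjecture.Cruxes.H413.K2E1BLEvaluationFunctionalCMThree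

end
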